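import Summits.ValiantsHypothesis.ValiantsHypothesis.Theorems.BarrierLeverDescentCertificateSufficesBlocks

/-!
# Route BarrierLever — SYMMETRIES of tropical-determinant certificates (UT-D, item
# stmt-ValiantsHypothesis-19316 `TropicalDetCertificatesExist`)

Helper file (`--supports stmt-ValiantsHypothesis-19316`; cell valiant-natproofs, rung V4, 𝒟-side;
prover seat val-np-p1). Closes NO item. It supplies the «routine» symmetry glue that every
certificate scheme of the planner memo `UTD-memo-g9.md` (§2 census «order + cube automorphism T»,
§3(o)/(p) «∃ coordinate order») silently uses: a UT-D certificate for a TRANSFORMED layout is as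
good as one for the layout itself.

**Setting.** A layout is `u, w : Fin r → Finset (Fin h)`; row literals `ρ_x a` (`Descent.rowL`),
column literals `κ_y c` (`Descent.colL`). For a weight `D` on `Fin (h+h) × Fin (h+h)` the cost of an
inner assignment `τ` on the block `(x, y)` is `tcost D x y τ = Σ_a D (ρ_x a) (κ_y (τ a))`, the
tropical determinant of the block is its minimum over `τ`, the outer cost of `σ : Perm (Fin r)` is
`ocost D u w σ = Σ_j min_τ tcost D (u (σ j)) (w j) τ`, and `HasCert u w` says that some `(D, π₀)`
has `π₀` as the UNIQUE minimiser of the outer cost — verbatim the conclusion of UT-D for `(u, w)`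
(`hasCert_iff`, `Iff.rfl`).

**Results.** `HasCert` is transported along
* re-indexing of rows and columns (`hasCert_reindex`: `u ∘ α`, `w ∘ β` for `α, β : Perm (Fin r)`);
* coordinate relabellings applied to the rows ALONE or to the columns ALONE
  (`hasCert_of_relabelRows`, `hasCert_of_relabelCols`: `x ↦ x.map γ` for `γ : Perm (Fin h)`; the
  weight is pulled back along the literal relabelling `relab γ`, the inner minimum absorbs the
  re-ordering `τ ↦ γ ∘ τ` / `τ ↦ τ ∘ γ⁻¹`);
* bit flips applied to the rows alone or to the columns alone (`hasCert_flipRows_iff`,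
  `hasCert_flipCols_iff`: `x ↦ x ∆ S`; the weight is pulled back along the literal swap
  `flipLit S`).
Hence the full group (cube automorphisms on rows) × (cube automorphisms on columns) acts on UT-D
certificates, and (`tropicalDetCertificatesExist_of_upToSymmetry`) UT-D — the signature of item
19316 VERBATIM — follows from certificates for layouts transformed by any `(α, S)` on the rows and
any `(β, T)` on the columns.

WHAT THIS IS NOT: no certificate is constructed here; UT-D (item 19316), TT / TNS / item 19717,
crux stmt-ValiantsHypothesis-14610 and `VP` versus `VNP` are untouched.
-/

-- layout Summits/ValiantsHypothesis/ValiantsHypothesis forces the duplicated namespace component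
set_option linter.dupNamespace false

namespace Summit.ValiantsHypothesis.ValiantsHypothesis.Theorems.BarrierLever.UTDSymm

open Finset
open Summit.ValiantsHypothesis.ValiantsHypothesis.Theorems.BarrierLever.Descent (rowL colL)

variable {h : ℕ}

/-! ## 1. Costs and the certificate predicate -/

/-- The cost of the inner assignment `τ` on the block (row point `x`, column point `y`) for the
weight `D`: `Σ_a D (ρ_x a) (κ_y (τ a))`. -/
def tcost (D : Fin (h + h) → Fin (h + h) → ℕ) (x y : Finset (Fin h)) (τ : Equiv.Perm (Fin h)) : ℕ :=
  ∑ a, D (rowL x a) (colL y (τ a))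

/-- The outer cost of `σ : Perm (Fin r)`: the sum over the columns `j` of the tropical determinants
of the blocks `(u (σ j), w j)`. -/
def ocost {r : ℕ} (D : Fin (h + h) → Fin (h + h) → ℕ) (u w : Fin r → Finset (Fin h))
    (σ : Equiv.Perm (Fin r)) : ℕ :=
  ∑ j, univ.inf' univ_nonempty (tcost D (u (σ j)) (w j))

/-- `HasCert u w`: the layout `(u, w)` carries a tropical-determinant certificate `(D, π₀)` —
`π₀` is the unique minimiser of the outer cost for `D` (the conclusion of UT-D, item 19316, for
`(u, w)`). -/
def HasCert {r : ℕ} (u w : Fin r → Finset (Fin h)) : Prop :=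
  ∃ (D : Fin (h + h) → Fin (h + h) → ℕ) (π₀ : Equiv.Perm (Fin r)),
    ∀ σ : Equiv.Perm (Fin r), σ ≠ π₀ → ocost D u w π₀ < ocost D u w σ

/-- `HasCert` is, verbatim, the conclusion of UT-D (item 19316) for the layout. -/
theorem hasCert_iff {r : ℕ} (u w : Fin r → Finset (Fin h)) :
    HasCert u w ↔ ∃ (D : Fin (h + h) → Fin (h + h) → ℕ) (π₀ : Equiv.Perm (Fin r)),
      ∀ σ : Equiv.Perm (Fin r), σ ≠ π₀ →
        ∑ j, Finset.univ.inf' Finset.univ_nonempty (fun τ : Equiv.Perm (Fin h) =>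
          ∑ a : Fin h, D (if a ∈ u (π₀ j) then Fin.castAdd h a else Fin.natAdd h a)
            (if τ a ∈ w j then Fin.natAdd h (τ a) else Fin.castAdd h (τ a))) <
        ∑ j, Finset.univ.inf' Finset.univ_nonempty (fun τ : Equiv.Perm (Fin h) =>
          ∑ a : Fin h, D (if a ∈ u (σ j) then Fin.castAdd h a else Fin.natAdd h a)
            (if τ a ∈ w j then Fin.natAdd h (τ a) else Fin.castAdd h (τ a))) :=
  Iff.rfl

/-- Two families of values indexed by inner assignments that dominate each other along maps
`Φ`, `Ψ` have the same minimum. -/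
theorem inf'_eq_of_maps (f g : Equiv.Perm (Fin h) → ℕ)
    (Φ Ψ : Equiv.Perm (Fin h) → Equiv.Perm (Fin h))
    (hfg : ∀ τ, f τ = g (Φ τ)) (hgf : ∀ τ, g τ = f (Ψ τ)) :
    univ.inf' univ_nonempty f = univ.inf' univ_nonempty g := by
  apply le_antisymm
  · refine Finset.le_inf' _ _ (fun τ _ => ?_)
    rw [hgf τ]
    exact Finset.inf'_le _ (mem_univ _)
  · refine Finset.le_inf' _ _ (fun τ _ => ?_)
    rw [hfg τ]
    exact Finset.inf'_le _ (mem_univ _)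

/-! ## 2. Re-indexing rows and columns -/

/-- Outer costs of a re-indexed layout are outer costs of the layout. -/
theorem ocost_reindex {r : ℕ} (D : Fin (h + h) → Fin (h + h) → ℕ) (u w : Fin r → Finset (Fin h))
    (α β σ : Equiv.Perm (Fin r)) :
    ocost D (u ∘ α) (w ∘ β) σ = ocost D u w ((β.symm.trans σ).trans α) := by
  unfold ocost
  refine Fintype.sum_equiv β _ _ (fun j => ?_)
  simp only [Function.comp_apply, Equiv.trans_apply, Equiv.symm_apply_apply]

/-- `HasCert` is invariant under re-indexing rows and columns. -/
theorem hasCert_reindex {r : ℕ} (u w : Fin r → Finset (Fin h)) (α β : Equiv.Perm (Fin r))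
    (hc : HasCert u w) : HasCert (u ∘ α) (w ∘ β) := by
  obtain ⟨D, π₀, hπ⟩ := hc
  refine ⟨D, (β.trans π₀).trans α.symm, fun σ hσ => ?_⟩
  rw [ocost_reindex, ocost_reindex]
  have h1 : (β.symm.trans ((β.trans π₀).trans α.symm)).trans α = π₀ := by
    ext j
    simp only [Equiv.trans_apply, Equiv.apply_symm_apply]
  rw [h1]
  refine hπ _ (fun heq => hσ ?_)
  ext j
  have hj := Equiv.ext_iff.mp heq (β j)
  simp only [Equiv.trans_apply, Equiv.symm_apply_apply] at hj
  simp only [Equiv.trans_apply]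
  rw [← hj, Equiv.symm_apply_apply]

/-! ## 3. Coordinate relabellings on one side -/

/-- Relabelling of literals along `γ : Perm (Fin h)`: `castAdd h a ↦ castAdd h (γ a)`,
`natAdd h a ↦ natAdd h (γ a)`. -/
def relab (γ : Equiv.Perm (Fin h)) (x : Fin (h + h)) : Fin (h + h) :=
  Fin.addCases (motive := fun _ => Fin (h + h)) (fun a => Fin.castAdd h (γ a))
    (fun a => Fin.natAdd h (γ a)) x

/-- `relab` on a positive literal. -/
theorem relab_castAdd (γ : Equiv.Perm (Fin h)) (a : Fin h) :
    relab γ (Fin.castAdd h a) = Fin.castAdd h (γ a) := by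
  unfold relab; exact Fin.addCases_left _

/-- `relab` on a negative literal. -/
theorem relab_natAdd (γ : Equiv.Perm (Fin h)) (a : Fin h) :
    relab γ (Fin.natAdd h a) = Fin.natAdd h (γ a) := by
  unfold relab; exact Fin.addCases_right _

/-- Row literals of a relabelled point. -/
theorem relab_rowL (γ : Equiv.Perm (Fin h)) (x : Finset (Fin h)) (a : Fin h) :
    relab γ (rowL x a) = rowL (x.map γ.toEmbedding) (γ a) := by
  unfold rowL
  by_cases ha : a ∈ x
  · have ha' : γ a ∈ x.map γ.toEmbedding := by
      rw [Finset.mem_map_equiv, Equiv.symm_apply_apply]; exact ha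
    rw [if_pos ha, if_pos ha', relab_castAdd]
  · have ha' : γ a ∉ x.map γ.toEmbedding := by
      rw [Finset.mem_map_equiv, Equiv.symm_apply_apply]; exact ha
    rw [if_neg ha, if_neg ha', relab_natAdd]

/-- Column literals of a relabelled point. -/
theorem relab_colL (γ : Equiv.Perm (Fin h)) (y : Finset (Fin h)) (c : Fin h) :
    relab γ (colL y c) = colL (y.map γ.toEmbedding) (γ c) := by
  unfold colL
  by_cases hc : c ∈ y
  · have hc' : γ c ∈ y.map γ.toEmbedding := by
      rw [Finset.mem_map_equiv, Equiv.symm_apply_apply]; exact hc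
    rw [if_pos hc, if_pos hc', relab_natAdd]
  · have hc' : γ c ∉ y.map γ.toEmbedding := by
      rw [Finset.mem_map_equiv, Equiv.symm_apply_apply]; exact hc
    rw [if_neg hc, if_neg hc', relab_castAdd]

/-- Block costs with the ROWS relabelled: pull the weight back on row literals and re-order the
inner assignment. -/
theorem tcost_relabRows (D : Fin (h + h) → Fin (h + h) → ℕ) (γ : Equiv.Perm (Fin h))
    (x y : Finset (Fin h)) (τ : Equiv.Perm (Fin h)) :
    tcost D (x.map γ.toEmbedding) y τ = tcost (fun p q => D (relab γ p) q) x y (γ.trans τ) := by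
  unfold tcost
  refine (Fintype.sum_equiv γ _ _ (fun a => ?_)).symm
  simp only [relab_rowL, Equiv.trans_apply]

/-- Block costs with the COLUMNS relabelled. -/
theorem tcost_relabCols (D : Fin (h + h) → Fin (h + h) → ℕ) (γ : Equiv.Perm (Fin h))
    (x y : Finset (Fin h)) (τ : Equiv.Perm (Fin h)) :
    tcost D x (y.map γ.toEmbedding) τ =
      tcost (fun p q => D p (relab γ q)) x y (τ.trans γ.symm) := by
  unfold tcost
  refine Finset.sum_congr rfl (fun a _ => ?_)
  simp only [relab_colL, Equiv.trans_apply, Equiv.apply_symm_apply]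

/-- A certificate for the layout with relabelled ROWS gives one for the layout. -/
theorem hasCert_of_relabelRows {r : ℕ} (u w : Fin r → Finset (Fin h)) (γ : Equiv.Perm (Fin h))
    (hc : HasCert (fun i => (u i).map γ.toEmbedding) w) : HasCert u w := by
  obtain ⟨D, π₀, hπ⟩ := hc
  refine ⟨fun p q => D (relab γ p) q, π₀, fun σ hσ => ?_⟩
  have hoc : ∀ σ' : Equiv.Perm (Fin r), ocost (fun p q => D (relab γ p) q) u w σ' =
      ocost D (fun i => (u i).map γ.toEmbedding) w σ' := by
    intro σ'
    unfold ocost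
    refine Finset.sum_congr rfl (fun j _ => ?_)
    refine inf'_eq_of_maps _ _ (fun τ => γ.symm.trans τ) (fun τ => γ.trans τ) (fun τ => ?_)
      (fun τ => tcost_relabRows D γ _ _ τ)
    rw [tcost_relabRows, ← Equiv.trans_assoc, Equiv.self_trans_symm, Equiv.refl_trans]
  rw [hoc, hoc]
  exact hπ σ hσ

/-- A certificate for the layout with relabelled COLUMNS gives one for the layout. -/
theorem hasCert_of_relabelCols {r : ℕ} (u w : Fin r → Finset (Fin h)) (γ : Equiv.Perm (Fin h))
    (hc : HasCert u (fun j => (w j).map γ.toEmbedding)) : HasCert u w := by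
  obtain ⟨D, π₀, hπ⟩ := hc
  refine ⟨fun p q => D p (relab γ q), π₀, fun σ hσ => ?_⟩
  have hoc : ∀ σ' : Equiv.Perm (Fin r), ocost (fun p q => D p (relab γ q)) u w σ' =
      ocost D u (fun j => (w j).map γ.toEmbedding) σ' := by
    intro σ'
    unfold ocost
    refine Finset.sum_congr rfl (fun j _ => ?_)
    refine inf'_eq_of_maps _ _ (fun τ => τ.trans γ) (fun τ => τ.trans γ.symm) (fun τ => ?_)
      (fun τ => tcost_relabCols D γ _ _ τ)
    rw [tcost_relabCols, Equiv.trans_assoc, Equiv.self_trans_symm, Equiv.trans_refl]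
  rw [hoc, hoc]
  exact hπ σ hσ

/-! ## 4. Bit flips on one side -/

/-- Swap the two literals of every coordinate in `S`. -/
def flipLit (S : Finset (Fin h)) (x : Fin (h + h)) : Fin (h + h) :=
  Fin.addCases (motive := fun _ => Fin (h + h))
    (fun a => if a ∈ S then Fin.natAdd h a else Fin.castAdd h a)
    (fun a => if a ∈ S then Fin.castAdd h a else Fin.natAdd h a) x

/-- `flipLit` on a positive literal. -/
theorem flipLit_castAdd (S : Finset (Fin h)) (a : Fin h) :
    flipLit S (Fin.castAdd h a) = if a ∈ S then Fin.natAdd h a else Fin.castAdd h a := by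
  unfold flipLit; exact Fin.addCases_left _

/-- `flipLit` on a negative literal. -/
theorem flipLit_natAdd (S : Finset (Fin h)) (a : Fin h) :
    flipLit S (Fin.natAdd h a) = if a ∈ S then Fin.castAdd h a else Fin.natAdd h a := by
  unfold flipLit; exact Fin.addCases_right _

/-- Row literals of a flipped point, flipped back. -/
theorem flipLit_rowL (S x : Finset (Fin h)) (a : Fin h) :
    flipLit S (rowL (symmDiff x S) a) = rowL x a := by
  unfold rowL
  by_cases ha : a ∈ x <;> by_cases hS : a ∈ S
  · have h1 : a ∉ symmDiff x S := by rw [Finset.mem_symmDiff]; tauto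
    rw [if_neg h1, if_pos ha, flipLit_natAdd, if_pos hS]
  · have h1 : a ∈ symmDiff x S := by rw [Finset.mem_symmDiff]; tauto
    rw [if_pos h1, if_pos ha, flipLit_castAdd, if_neg hS]
  · have h1 : a ∈ symmDiff x S := by rw [Finset.mem_symmDiff]; tauto
    rw [if_pos h1, if_neg ha, flipLit_castAdd, if_pos hS]
  · have h1 : a ∉ symmDiff x S := by rw [Finset.mem_symmDiff]; tauto
    rw [if_neg h1, if_neg ha, flipLit_natAdd, if_neg hS]

/-- Column literals of a flipped point, flipped back. -/
theorem flipLit_colL (S y : Finset (Fin h)) (c : Fin h) :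
    flipLit S (colL (symmDiff y S) c) = colL y c := by
  unfold colL
  by_cases hc : c ∈ y <;> by_cases hS : c ∈ S
  · have h1 : c ∉ symmDiff y S := by rw [Finset.mem_symmDiff]; tauto
    rw [if_neg h1, if_pos hc, flipLit_castAdd, if_pos hS]
  · have h1 : c ∈ symmDiff y S := by rw [Finset.mem_symmDiff]; tauto
    rw [if_pos h1, if_pos hc, flipLit_natAdd, if_neg hS]
  · have h1 : c ∈ symmDiff y S := by rw [Finset.mem_symmDiff]; tauto
    rw [if_pos h1, if_neg hc, flipLit_natAdd, if_pos hS]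
  · have h1 : c ∉ symmDiff y S := by rw [Finset.mem_symmDiff]; tauto
    rw [if_neg h1, if_neg hc, flipLit_castAdd, if_neg hS]

/-- Outer costs with flipped ROWS and the weight pulled back along the row-literal swap. -/
theorem ocost_flipRows {r : ℕ} (D : Fin (h + h) → Fin (h + h) → ℕ) (u w : Fin r → Finset (Fin h))
    (S : Finset (Fin h)) (σ : Equiv.Perm (Fin r)) :
    ocost (fun p q => D (flipLit S p) q) (fun i => symmDiff (u i) S) w σ = ocost D u w σ := by
  unfold ocost tcost
  simp only [flipLit_rowL]

/-- Outer costs with flipped COLUMNS and the weight pulled back along the column-literal swap. -/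
theorem ocost_flipCols {r : ℕ} (D : Fin (h + h) → Fin (h + h) → ℕ) (u w : Fin r → Finset (Fin h))
    (T : Finset (Fin h)) (σ : Equiv.Perm (Fin r)) :
    ocost (fun p q => D p (flipLit T q)) u (fun j => symmDiff (w j) T) σ = ocost D u w σ := by
  unfold ocost tcost
  simp only [flipLit_colL]

/-- `HasCert` is invariant under bit flips of the ROWS. -/
theorem hasCert_flipRows_iff {r : ℕ} (u w : Fin r → Finset (Fin h)) (S : Finset (Fin h)) :
    HasCert (fun i => symmDiff (u i) S) w ↔ HasCert u w := by
  have key : ∀ u' : Fin r → Finset (Fin h), HasCert u' w → HasCert (fun i => symmDiff (u' i) S) w :=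
    fun u' ⟨D, π₀, hπ⟩ => ⟨fun p q => D (flipLit S p) q, π₀, fun σ hσ => by
      rw [ocost_flipRows, ocost_flipRows]; exact hπ σ hσ⟩
  refine ⟨fun hc => ?_, key u⟩
  have h2 := key _ hc
  have hu : (fun i => symmDiff (symmDiff (u i) S) S) = u :=
    funext (fun i => symmDiff_symmDiff_cancel_right _ _)
  rwa [hu] at h2

/-- `HasCert` is invariant under bit flips of the COLUMNS. -/
theorem hasCert_flipCols_iff {r : ℕ} (u w : Fin r → Finset (Fin h)) (T : Finset (Fin h)) :
    HasCert u (fun j => symmDiff (w j) T) ↔ HasCert u w := by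
  have key : ∀ w' : Fin r → Finset (Fin h), HasCert u w' → HasCert u (fun j => symmDiff (w' j) T) :=
    fun w' ⟨D, π₀, hπ⟩ => ⟨fun p q => D p (flipLit T q), π₀, fun σ hσ => by
      rw [ocost_flipCols, ocost_flipCols]; exact hπ σ hσ⟩
  refine ⟨fun hc => ?_, key w⟩
  have h2 := key _ hc
  have hw : (fun j => symmDiff (symmDiff (w j) T) T) = w :=
    funext (fun j => symmDiff_symmDiff_cancel_right _ _)
  rwa [hw] at h2

/-! ## 5. Assembly: UT-D from certificates up to symmetry -/

/-- **UT-D up to symmetry.** If every injective layout admits a tropical-determinant certificate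
after transforming its rows by some cube automorphism `x ↦ (x ∆ S).map α` and its columns by some
(possibly different) cube automorphism `y ↦ (y ∆ T).map β`, then UT-D — the signature of item
stmt-ValiantsHypothesis-19316 `TropicalDetCertificatesExist`, VERBATIM — holds. -/
theorem tropicalDetCertificatesExist_of_upToSymmetry
    (hyp : ∀ (h r : ℕ) (u w : Fin r → Finset (Fin h)), Function.Injective u →
      Function.Injective w → ∃ (α β : Equiv.Perm (Fin h)) (S T : Finset (Fin h)),
        HasCert (fun i => (symmDiff (u i) S).map α.toEmbedding)
          (fun j => (symmDiff (w j) T).map β.toEmbedding)) :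
    ∀ (h r : ℕ) (u w : Fin r → Finset (Fin h)), Function.Injective u → Function.Injective w →
    ∃ (D : Fin (h + h) → Fin (h + h) → ℕ) (π₀ : Equiv.Perm (Fin r)),
      ∀ σ : Equiv.Perm (Fin r), σ ≠ π₀ →
        ∑ j, Finset.univ.inf' Finset.univ_nonempty (fun τ : Equiv.Perm (Fin h) =>
          ∑ a : Fin h, D (if a ∈ u (π₀ j) then Fin.castAdd h a else Fin.natAdd h a)
            (if τ a ∈ w j then Fin.natAdd h (τ a) else Fin.castAdd h (τ a))) <
        ∑ j, Finset.univ.inf' Finset.univ_nonempty (fun τ : Equiv.Perm (Fin h) =>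
          ∑ a : Fin h, D (if a ∈ u (σ j) then Fin.castAdd h a else Fin.natAdd h a)
            (if τ a ∈ w j then Fin.natAdd h (τ a) else Fin.castAdd h (τ a))) := by
  intro h r u w hu hw
  obtain ⟨α, β, S, T, hc⟩ := hyp h r u w hu hw
  have h1 : HasCert (fun i => symmDiff (u i) S) (fun j => (symmDiff (w j) T).map β.toEmbedding) :=
    hasCert_of_relabelRows _ _ α hc
  have h2 : HasCert (fun i => symmDiff (u i) S) (fun j => symmDiff (w j) T) :=
    hasCert_of_relabelCols _ _ β h1
  exact (hasCert_iff u w).mp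
    ((hasCert_flipRows_iff u w S).mp ((hasCert_flipCols_iff _ w T).mp h2))

/-- The layout-wise form: a certificate for a transformed layout is a certificate for the layout. -/
theorem hasCert_of_upToSymmetry {r : ℕ} (u w : Fin r → Finset (Fin h)) (α β : Equiv.Perm (Fin h))
    (S T : Finset (Fin h))
    (hc : HasCert (fun i => (symmDiff (u i) S).map α.toEmbedding)
      (fun j => (symmDiff (w j) T).map β.toEmbedding)) : HasCert u w := by
  have h1 : HasCert (fun i => symmDiff (u i) S) (fun j => (symmDiff (w j) T).map β.toEmbedding) :=
    hasCert_of_relabelRows _ _ α hc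
  have h2 : HasCert (fun i => symmDiff (u i) S) (fun j => symmDiff (w j) T) :=
    hasCert_of_relabelCols _ _ β h1
  exact (hasCert_flipRows_iff u w S).mp ((hasCert_flipCols_iff _ w T).mp h2)

end Summit.ValiantsHypothesis.ValiantsHypothesis.Theorems.BarrierLever.UTDSymm
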